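import Summits.Ventures.PercRepro.ProfileGapMonoThresholdGenericPred
import Summits.Ventures.PercRepro.ProfileGapMonoThresholdRowLink

/-!
# PercRepro — `(GM)_q` AT THE LEVEL `u = q + 1` AT EVERY `q`-GENERIC POINT, WITHOUT A RANK CONDITION (p5, gen 25;
`proofs/P5-GM1.md` §25(g); announced INBOX before typing)

The generic template of `(GM)_q` (`gapMonoQ_of_generic`, p10; `gapMonoQ_of_genericAt`, p5 g21) works below the top
levels only: `u + q ≤ ρ(E)` resp. `u + q ≤ ρ(E) + 1`.  For the first off-diagonal level `u = q + 1` the threshold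
family removes the rank condition: `DelMonoT N z (q+1) (q+1)` is `GapMonoQ N z q (q+1)` (`delMonoT_self_iff_gapMonoQ`),
and `delMonoT_of_genericQ_pred` at co-rank `q + 1` needs exactly `GenericQ N z q` and the row `(q−1, q)` of `N ／ z`
(`ThresholdIneq (N ／ z) q q`, the offset-`0` form of that row).  Hence **`gapMonoQ_succ_of_genericQ`**: for every
`q ≥ 1`, every non-loop `q`-generic `z`, every finite matroid of every rank, `(GM)_q` at `u = q + 1` from the row
`(q−1, q)` of `N ／ z`; with the rows `(1, 2)` and `(2, 3)` of every matroid (tree theorems) this is UNCONDITIONAL at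
`q = 2` and `q = 3`: `gapMonoQ_two_three_of_genericQ`, `gapMonoQ_three_four_of_genericQ`.

* **`gapMonoQ_succ_of_genericQ`**, `gapMonoQ_two_three_of_genericQ`, `gapMonoQ_three_four_of_genericQ`.
-/

open scoped Matroid

namespace PercRepro.Cogirth

open Finset ThmH Skew Shadow Profile

variable {α : Type} [DecidableEq α] {M : Matroid α} [M.Finite]

section GenericSuccRow

variable {N : Matroid α} [N.Finite] {z : α} {q : ℕ}

/-- **`(GM)_q` at the level `u = q + 1` at every `q`-generic non-loop point, every rank** (`1 ≤ q`), from the row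
`(q−1, q)` of `N ／ z`. -/
theorem gapMonoQ_succ_of_genericQ (hzI : N.Indep {z}) (hg : GenericQ N z q) (hq : 1 ≤ q)
    (hdel : ProfileIneqMinusQ (N ／ ({z} : Set α)) (q - 1) q) : GapMonoQ N z q (q + 1) := by
  -- the row `(q−1, q)` of `N ／ z` in its offset-`0` threshold form
  have hrow : ThresholdIneq (N ／ ({z} : Set α)) q q :=
    (thresholdIneq_pred_iff hq).1 ((thresholdIneq_iff_row hq).2 hdel)
  have hg' : GenericQ N z (q + 1 - 1) := by
    rw [Nat.add_sub_cancel]; exact hg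
  have hrow' : ThresholdIneq (N ／ ({z} : Set α)) (q + 1 - 1) (q + 1 - 1) := by
    rw [Nat.add_sub_cancel]; exact hrow
  have hdm : DelMonoT N z (q + 1) (q + 1) :=
    delMonoT_of_genericQ_pred hzI hg' (by omega) (by omega) hrow'
  have h := (delMonoT_self_iff_gapMonoQ (by omega : 1 ≤ q + 1)).1 hdm
  rwa [Nat.add_sub_cancel] at h

/-- **`(GM)_2` at `u = 3` at every `2`-generic non-loop point, every rank, unconditionally** (the row `(1, 2)` of
`N ／ z` is a theorem). -/
theorem gapMonoQ_two_three_of_genericQ (hzI : N.Indep {z}) (hg : GenericQ N z 2) : GapMonoQ N z 2 3 :=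
  gapMonoQ_succ_of_genericQ hzI hg (by norm_num) (profileIneqMinusQ_one_all _ (by norm_num))

/-- **`(GM)_3` at `u = 4` at every `3`-generic non-loop point, every rank, unconditionally** (the row `(2, 3)` of
`N ／ z` is a theorem). -/
theorem gapMonoQ_three_four_of_genericQ (hzI : N.Indep {z}) (hg : GenericQ N z 3) : GapMonoQ N z 3 4 :=
  gapMonoQ_succ_of_genericQ hzI hg (by norm_num)
    ((thresholdIneq_iff_row (by norm_num)).1 (thresholdIneq_row_of_le_three _ (by norm_num) (by norm_num)))

end GenericSuccRow

end PercRepro.Cogirth
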